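import Literature.NumberTheory.EllipticCurves.KellerYin2024.PotentiallyGoodOrdinaryHeegnerPointMainConjecture
import Literature.NumberTheory.EllipticCurves.TwistedHeegnerFamilyExistence
import Literature.NumberTheory.EllipticCurves.TwistedHeegnerTransportSign
import Literature.NumberTheory.EllipticCurves.LambdaAdicSelmerDataProofs
import Literature.NumberTheory.EllipticCurves.IwasawaSelmerDualProofs
import Literature.NumberTheory.EllipticCurves.HeegnerHypothesisKroneckerProofs
import Literature.NumberTheory.QuadraticFields.HeegnerCondition
import HarnessLib

/-!
# The data `(D, F, X)` of Keller–Yin's Heegner-point statements EXIST under `HPMCHypotheses`: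
# non-vacuity of `thm336_hpmc_divisibility_OPEN` / `thm351_hpmc_equality_OPEN` /
# `prop344_grMC_of_hpmc_OPEN`, and the printed route "Thm. 3.3.6 + Prop. 3.4.4 ⟹ (GrMC)" with no
# data hypotheses — THEOREMS ONLY (no definition, no named fact, no claim)

Cross-ladder LITERATURE-TYPING layer (D-0088(4)), cell `bsd-littype`, seat `bsd-littype-06` (gen 4).
Sequel of `PotentiallyGoodOrdinaryHeegnerPointMainConjecture.lean` (gen 3), whose three PREPRINT
claims about Keller–Yin arXiv:2410.23241v1 Thm. 3.3.6 / Thm. 3.5.1 (last clause) / Prop. 3.4.4 are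
quantified over ALL `Λ`-adic Selmer data `D : LambdaAdicSelmerData κ γ`, ALL twisted Heegner families
`F : TwistedHeegnerFamily N′ W W′ K κ jbar` and ALL Selmer-dual data `X : SelmerDualData κ γ`, and whose
docstring recorded "their existence is not asserted anywhere in the tree" (so a refuter could not
rule out that the claims are vacuously true). This file proves that under the claims' own hypothesis
bundle `HPMCHypotheses ι′ W W′ K v v̄ κ γ N N′` ALL THREE KINDS OF DATA EXIST:

* `D` — unconditionally: `HPMCHypotheses.nonempty_lambdaAdicSelmerData` (the tree THEOREM
  `LambdaAdicSelmerDataExists.nonempty_lambdaAdicSelmerData`, typer 05's discharge of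
  `lambdaAdicSelmerData_exists_unique`, at the topological generator `γ` of the bundle);
* `X` — unconditionally: `HPMCHypotheses.nonempty_selmerDualData` (tree THEOREM
  `nonempty_selmerDualData_holds`, Greenberg LNM 1716 §1);
* `F` — `HPMCHypotheses.nonempty_twistedHeegnerFamily`, for every parametrisation datum `Dt′` of
  `E′` at level `N′` and every `jbar`, CONDITIONALLY on exactly the two refereed named facts
  `exists_isHeegnerNormPoint N′ W′ K p` (Howard 2004 §2.7/§3.3) and `sqrt_pStar_mem_ringClassField`
  (Cornut–Vatsal 2007 §1.1 + Cox): the theorem `nonempty_twistedHeegnerFamily_of`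
  (`TwistedHeegnerFamilyExistence.lean`) fed with the bundle's fields — `W′` is elliptic
  (`C • W^{(p*)} = W′`), the Heegner hypothesis for `N = N′p²` restricts to `N′` and forces `p ∤ d_K`
  (`Literature.SatisfiesHeegnerHypothesis.not_dvd_discr`), `p > 2`, and an orientation `β` exists
  (`exists_dvd_sq_sub_discr_of_ncard_primesOver`, Gross 1984 §3).

Consequently the printed route of Keller–Yin §3.3–§3.4 — "Thm. 3.3.6 gives (HPMC) ⊃; Prop. 3.4.4
turns it into (GrMC) ⊃" — is available in the kernel WITHOUT data hypotheses:
`grMCDivisibility_of_OPEN_of_facts` (the two OPEN claims + the two refereed facts + a parametrisation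
datum of `E′` ⟹ `GrMCDivisibility ι′ W K v v̄ κ γ f`, the conclusion of the gen-0 Greenberg-form claim
`thm336_oneSided_isTorsion_mem_charIdeal_OPEN` at these parameters). Nothing here asserts any of the
OPEN claims; every statement is an implication or an existence theorem proved from the tree.

Not here: the modular parametrisation datum `Dt′ : ModularParametrizationData W′ N′` stays an INPUT
(modularity of `E′` at level `N′ = N(E′)`; the identity `N(E^{(p*)}) = N/p²` in Case (I) is not in the
tree as a conductor computation), as in the siblings `nonempty_heegnerFamily_of` /
`nonempty_twistedHeegnerFamily_of`.

## References

* Keller–Yin, arXiv:2410.23241v1 (2024), §3.1 (the pair `(f̃, χ_ε)`, `N = N′p²`), Thm. 3.3.6, Prop.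
  3.4.4, Thm. 3.5.1 — UNREFEREED; only the hypotheses of the typed claims are unpacked here.
* [Howard2004HeegnerKolyvagin] §2.7, §3.3 (Heegner points `P[m] ∈ E(K[m])` and their norms).
* [GreenbergLNM1716] R. Greenberg, LNM 1716 (1999), §1 (the `Λ`-module `X = Sel^∨`).
* [PerrinRiou1987BSMF] §0 (`𝔖_p(K_∞)` as a compact `Λ`-module), [Gross1984] §3 (`D ≡ β² (mod 4N)`).
* Cell documents: `run/shared/lean/pub/bsd-littype/OPEN-QUESTIONS-06.md` §D (Q-D4), HANDOFF § 06.
-/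

set_option autoImplicit false

noncomputable section

open scoped Classical NumberField

open WeierstrassCurve NumberField IsDedekindDomain Field
  Literature.NumberTheory.EllipticCurves Literature.NumberTheory.EllipticCurves.ModularForms

namespace Literature.NumberTheory.EllipticCurves.KellerYin2024

variable {p : ℕ} [Fact p.Prime] {ι' : PadicAlgCl p ≃+* ℂ} {W W' : WeierstrassCurve ℚ} [W.IsElliptic]
  [W.IsGloballyMinimal] {K : Type} [Field K] [NumberField K] {v vbar : HeightOneSpectrum (𝓞 K)}
  {κ : ZpExtension K p} {γ : absoluteGaloisGroup K} {N N' : ℕ}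

namespace HPMCHypotheses

/-! ### §1 Unpacking the bundle -/

/-- **`E′` is an elliptic curve**: `W′ = C • W^{(p*)}` with `W` elliptic and `p* ≠ 0`
(`isElliptic_quadraticTwist`; a change of variables preserves `Δ ≠ 0`). Keller–Yin §3.1 (`f̃ = f_{E′}`
a newform, `E′` the `ℚ`-form of `E`). [claim: KellerYin2024PotOrd, status: under-review] -/
theorem isElliptic_twist (h : HPMCHypotheses ι' W W' K v vbar κ γ N N') : W'.IsElliptic := by
  obtain ⟨C, hC⟩ := h.twist
  have hp : p.Prime := Fact.out
  have hd : ((-1 : ℚ) ^ (p / 2) * p) ≠ 0 :=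
    mul_ne_zero (pow_ne_zero _ (by norm_num)) (Nat.cast_ne_zero.mpr hp.ne_zero)
  haveI := W.isElliptic_quadraticTwist hd
  rw [← hC]
  infer_instance

/-- `N′ ∣ N` (`N = N′p²`, Keller–Yin §3.1 Case (I)). [claim: KellerYin2024PotOrd, status: under-review] -/
theorem level'_dvd_level (h : HPMCHypotheses ι' W W' K v vbar κ γ N N') : N' ∣ N :=
  ⟨p ^ 2, h.level_eq⟩

/-- `p ∣ N` (`N = N′p²`). [claim: KellerYin2024PotOrd, status: under-review] -/
theorem p_dvd_level (h : HPMCHypotheses ι' W W' K v vbar κ γ N N') : p ∣ N :=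
  ⟨N' * p, by rw [h.level_eq]; ring⟩

/-- **The Heegner hypothesis for `N′`** (inherited from `N = N′p²`, `SatisfiesHeegnerHypothesis.of_dvd`).
[claim: KellerYin2024PotOrd, status: under-review] -/
theorem heegner' (h : HPMCHypotheses ι' W W' K v vbar κ γ N N') : SatisfiesHeegnerHypothesis N' K :=
  h.setting.heegner.of_dvd h.level'_dvd_level

/-- **`p ∤ d_K`**: `p ∣ N` splits in `K` under the Heegner hypothesis for `N`, hence is unramified
(`Literature.SatisfiesHeegnerHypothesis.not_dvd_discr`). [claim: KellerYin2024PotOrd, status: under-review] -/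
theorem not_dvd_discr (h : HPMCHypotheses ι' W W' K v vbar κ γ N N') :
    ¬ (p : ℤ) ∣ NumberField.discr K :=
  Literature.SatisfiesHeegnerHypothesis.not_dvd_discr h.setting.imagQuad.1 h.setting.heegner
    (Fact.out : p.Prime) h.p_dvd_level

/-- `p ≠ 2` (`p > 2`). [claim: KellerYin2024PotOrd, status: under-review] -/
theorem p_ne_two (h : HPMCHypotheses ι' W W' K v vbar κ γ N N') : p ≠ 2 :=
  fun hp ↦ absurd h.setting.two_lt (by rw [hp]; exact lt_irrefl 2)

/-- **An orientation exists**: `β² ≡ d_K (mod 4N′)` for some `β` (Gross 1984 §3; the tree's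
`exists_dvd_sq_sub_discr_of_ncard_primesOver` under the Heegner hypothesis for `N′`).
[cite: Gross1984, §3 (D ≡ β² (mod 4N))] -/
theorem exists_dvd_sq_sub_discr [NeZero N'] (h : HPMCHypotheses ι' W W' K v vbar κ γ N N') :
    ∃ β : ℤ, (4 * N' : ℤ) ∣ β ^ 2 - NumberField.discr K :=
  Literature.NumberTheory.QuadraticFields.Quadratic.exists_dvd_sq_sub_discr_of_ncard_primesOver
    h.setting.imagQuad.1 (NeZero.ne N') h.heegner'

/-! ### §2 The three kinds of data exist -/

/-- **`D` exists**: a `Λ`-adic Selmer datum `𝔖_p(E/K_∞)` for the topological generator `γ` of the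
bundle (tree theorem `LambdaAdicSelmerDataExists.nonempty_lambdaAdicSelmerData`; Perrin-Riou 1987 §0,
Howard 2004 Def. 3.2.3). [cite: PerrinRiou1987BSMF, §0 p. 402 (𝔖_p(K_∞), limite projective)] -/
theorem nonempty_lambdaAdicSelmerData (h : HPMCHypotheses ι' W W' K v vbar κ γ N N') :
    Nonempty ((W.baseChange K).LambdaAdicSelmerData κ γ) :=
  LambdaAdicSelmerDataExists.nonempty_lambdaAdicSelmerData (W.baseChange K) p κ h.topGenerator

/-- **`X` exists**: a Selmer-dual datum `Sel_{p^∞}(E/K_∞)^∨` as a `Λ`-module with `T = γ − 1` (tree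
theorem `nonempty_selmerDualData_holds`; Greenberg LNM 1716 §1).
[cite: GreenbergLNM1716, §1 (after Conj. 1.3: X = Sel^∨ as a Λ-module)] -/
theorem nonempty_selmerDualData (h : HPMCHypotheses ι' W W' K v vbar κ γ N N') :
    Nonempty ((W.baseChange K).SelmerDualData κ γ) :=
  (W.baseChange K).nonempty_selmerDualData_holds κ γ h.topGenerator

/-- **`F` exists**: under `HPMCHypotheses`, for every parametrisation datum `Dt′` of `E′` at level `N′`
and every `jbar : K̄ → ℂ` there is a twisted Heegner family `TwistedHeegnerFamily N′ W W′ K κ jbar`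
(`nonempty_twistedHeegnerFamily_of` fed with §1), CONDITIONALLY on the two refereed named facts
`exists_isHeegnerNormPoint N′ W′ K p` and `sqrt_pStar_mem_ringClassField`. Keller–Yin, proof of
Thm. 3.3.5 (p0018 L14: "these images are nothing but the `z_{f,𝒪}` in [CastellaHsieh] where their
`χ` is our `χ_ε`"). [cite: Howard2004HeegnerKolyvagin, §2.7 and §3.3 (P[m] ∈ E(K[m]) and its norms)]
[cite: CastellaHsieh2018, §4.4 (z_{f,χ,c})] -/
theorem nonempty_twistedHeegnerFamily [NeZero N'] (h : HPMCHypotheses ι' W W' K v vbar κ γ N N')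
    (hH : exists_isHeegnerNormPoint N' W' K p) (hG : sqrt_pStar_mem_ringClassField)
    (Dt : ModularParametrizationData W' N') (jbar : AlgebraicClosure K →+* ℂ) :
    Nonempty (TwistedHeegnerFamily N' W W' K κ jbar) := by
  haveI := h.isElliptic_twist
  obtain ⟨C, hC⟩ := h.twist
  obtain ⟨β, hβ⟩ := h.exists_dvd_sq_sub_discr
  exact nonempty_twistedHeegnerFamily_of hH hG h.setting.imagQuad h.heegner' h.not_dvd_level
    h.p_ne_two h.not_dvd_discr hC κ Dt hβ jbar

/-- **All data of the Heegner-point statements exist at once** (`D`, `F`, `X`), under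
`HPMCHypotheses`, a parametrisation datum of `E′` and the two refereed facts.
[cite: Howard2004HeegnerKolyvagin, §3.3 (the objects 𝔖, 𝐇 ⊆ 𝔖, X of Thm. B)] -/
theorem exists_data [NeZero N'] (h : HPMCHypotheses ι' W W' K v vbar κ γ N N')
    (hH : exists_isHeegnerNormPoint N' W' K p) (hG : sqrt_pStar_mem_ringClassField)
    (Dt : ModularParametrizationData W' N') (jbar : AlgebraicClosure K →+* ℂ) :
    ∃ (_ : (W.baseChange K).LambdaAdicSelmerData κ γ) (_ : TwistedHeegnerFamily N' W W' K κ jbar)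
      (_ : (W.baseChange K).SelmerDualData κ γ), True := by
  obtain ⟨D⟩ := h.nonempty_lambdaAdicSelmerData
  obtain ⟨F⟩ := h.nonempty_twistedHeegnerFamily hH hG Dt jbar
  obtain ⟨X⟩ := h.nonempty_selmerDualData
  exact ⟨D, F, X, trivial⟩

end HPMCHypotheses

/-! ### §3 The printed route §3.3–§3.4 without data hypotheses -/

/-- **Keller–Yin's route to the Greenberg divisibility, data-free**: the PREPRINT claims Thm. 3.3.6
(`thm336_hpmc_divisibility_OPEN`) and Prop. 3.4.4 (`prop344_grMC_of_hpmc_OPEN`), the two REFEREED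
facts `exists_isHeegnerNormPoint N′ W′ K p` / `sqrt_pStar_mem_ringClassField`, and a parametrisation
datum of `E′` at level `N′` give `GrMCDivisibility ι′ W K v v̄ κ γ f` under `HPMCHypotheses` — the
sibling's `grMCDivisibility_of_OPEN` with its data arguments `(D, F, X)` DISCHARGED by §2 (any
`jbar`, e.g. `IsAlgClosed.lift`). CONDITIONAL on the two OPEN claims; nothing else asserted.
[claim: KellerYin2024PotOrd, status: under-review] -/
theorem grMCDivisibility_of_OPEN_of_facts (h336 : thm336_hpmc_divisibility_OPEN)
    (h344 : prop344_grMC_of_hpmc_OPEN) [Fact (κ.IsTopGenerator γ)] [NeZero N] [NeZero N']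
    {f : CuspForm (CongruenceSubgroup.Gamma0 N) 2} (hf : IsNewformOf W f)
    (hyp : HPMCHypotheses ι' W W' K v vbar κ γ N N') (hH : exists_isHeegnerNormPoint N' W' K p)
    (hG : sqrt_pStar_mem_ringClassField) (Dt : ModularParametrizationData W' N')
    (jbar : AlgebraicClosure K →+* ℂ) : GrMCDivisibility ι' W K v vbar κ γ f := by
  obtain ⟨D, F, X, -⟩ := hyp.exists_data hH hG Dt jbar
  exact grMCDivisibility_of_OPEN h336 h344 ι' W W' K v vbar κ γ hf jbar hyp D F X

/-- **The conclusion of the gen-0 Greenberg-form claim follows from the Heegner-point claims** at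
every parameter set carrying `HPMCHypotheses` and a parametrisation datum of `E′`: Thm. 3.3.6 +
Prop. 3.4.4 (OPEN) + the two refereed facts ⟹ the body of
`thm336_oneSided_isTorsion_mem_charIdeal_OPEN` (`𝔛` torsion and the frame divisibility), via
`thm336_oneSided_iff_grMCDivisibility`. A kernel-checked consistency edge between the two typed
currencies of this directory; CONDITIONAL on the OPEN claims. [claim: KellerYin2024PotOrd, status: under-review] -/
theorem xAc_isTorsion_and_frame_dvd_of_OPEN_of_facts (h336 : thm336_hpmc_divisibility_OPEN)
    (h344 : prop344_grMC_of_hpmc_OPEN) [Fact (κ.IsTopGenerator γ)] [NeZero N] [NeZero N']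
    {f : CuspForm (CongruenceSubgroup.Gamma0 N) 2} (hf : IsNewformOf W f)
    (hyp : HPMCHypotheses ι' W W' K v vbar κ γ N N') (hH : exists_isHeegnerNormPoint N' W' K p)
    (hG : sqrt_pStar_mem_ringClassField) (Dt : ModularParametrizationData W' N') :
    Module.IsTorsion (IwasawaAlgebra p) (Castella2018.AcSelmer.XAc (W.baseChange K) p κ vbar ∅ γ) ∧
    ∀ (ΩK : ℂ) (Ωp : ℂ_[p]) (L : UnrSeries p),
      ΩK ≠ 0 → Ωp ≠ 0 → IsBDPLFunction ι' v κ γ f ΩK Ωp L →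
      ∀ (j : ℤ_[p] →+* unrIntegers p),
        (∀ x : ℤ_[p], ((j x : unrIntegers p) :
          ℂ_[p]) = algebraMap ℚ_[p] ℂ_[p] (x : ℚ_[p])) →
        ∃ k : ℕ, PowerSeries.C ((p : unrIntegers p)
            ^ k) * L ∈
          (Castella2018.AcSelmer.XAc.charIdeal (W.baseChange K) p κ vbar ∅ γ).map (PowerSeries.map j) :=
  haveI : Algebra.IsAlgebraic ℚ (AlgebraicClosure K) := Algebra.IsAlgebraic.trans ℚ K _
  grMCDivisibility_of_OPEN_of_facts h336 h344 hf hyp hH hG Dt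
    (IsAlgClosed.lift (R := ℚ) (M := ℂ) (S := AlgebraicClosure K)).toRingHom

/-! ### §4 `F` exists WITH the `χ_ε`-dictionary (sequel `TwistedHeegnerTransportSign.lean`) -/

/-- **Under `HPMCHypotheses` a twisted Heegner family exists whose norm points ARE the transports of
the `χ_ε`-twisted norms of the Heegner points of `E′`**: for every parametrisation datum `Dt′` of
`E′` and every `jbar` there are `δ = √p* ∈ K̄` and a family `F` with `F.Dt = Dt′` such that for every
`j`, `F.z j = θ_C(∑_{r ∈ R_j} χ(r) r·P′)` with `P′` a `K[p^{j+1}]`-rational Heegner point of `E′` of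
conductor `p^{j+1}`, `R_j` a transversal of `Gal(K̄/K[p^{j+1}])` in `Gal(K̄/K_j)` and
`χ = genusSign δ` the quadratic character of `K(√p*)/K` (= `χ_ε|_{G_K}`, Keller–Yin Prop. 3.1.3) —
the sentence "these images are nothing but the `z_{f,𝒪}` in [CastellaHsieh] where their `χ` is our
`χ_ε`" (proof of Thm. 3.3.5, p0018 L14) read at Case (I) for an elliptic curve, existence and
dictionary both kernel-checked (`exists_twistedHeegnerFamily_z_eq_equiv_sum_genusSign_smul` fed with
§1). CONDITIONAL on the two refereed named facts only; nothing of Keller–Yin is asserted.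
[cite: CastellaHsieh2018, §4.4 (the χ-components z_{f,χ,c} of the Heegner classes)]
[cite: SilvermanAEC2009, X.2 Example 2.4 (ξ_σ = [χ(σ)])] -/
theorem HPMCHypotheses.exists_twistedHeegnerFamily_z_eq_equiv_sum_genusSign_smul [NeZero N']
    (h : HPMCHypotheses ι' W W' K v vbar κ γ N N')
    (hH : exists_isHeegnerNormPoint N' W' K p) (hG : sqrt_pStar_mem_ringClassField)
    (Dt : ModularParametrizationData W' N') (jbar : AlgebraicClosure K →+* ℂ) :
    ∃ (δ : AlgebraicClosure K)
      (_ : δ ^ 2 = algebraMap ℚ (AlgebraicClosure K) ((-1 : ℚ) ^ (p / 2) * p))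
      (F : TwistedHeegnerFamily N' W W' K κ jbar), F.Dt = Dt ∧
      ∀ j, ∃ (x' : geomPoints (W'.baseChange K)) (R : Finset (Field.absoluteGaloisGroup K)),
        IsHeegnerGeomPoint N' W' K F.Dt F.β (p ^ (j + 1)) jbar x' ∧
        (∀ σ ∈ ringClassSubgroup K (p ^ (j + 1)) jbar, σ • x' = x') ∧
        (↑R ⊆ (κ.layerSubgroup j : Set (Field.absoluteGaloisGroup K))) ∧
        (∀ τ ∈ κ.layerSubgroup j,
          ∃! r, r ∈ R ∧ r⁻¹ * τ ∈ ringClassSubgroup K (p ^ (j + 1)) jbar) ∧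
        F.z j = F.T.equiv
          (∑ r ∈ R, ((genusSign δ (Field.absoluteGaloisGroup.toAlgEquiv K r) : ℤˣ) : ℤ) •
            (r • x')) := by
  haveI := h.isElliptic_twist
  obtain ⟨C, hC⟩ := h.twist
  obtain ⟨β, hβ⟩ := h.exists_dvd_sq_sub_discr
  obtain ⟨δ, hδ2, F, hDt, -, hz⟩ :=
    Literature.NumberTheory.EllipticCurves.exists_twistedHeegnerFamily_z_eq_equiv_sum_genusSign_smul
      hH hG h.setting.imagQuad h.heegner' h.not_dvd_level h.p_ne_two h.not_dvd_discr hC κ Dt hβ jbar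
  exact ⟨δ, hδ2, F, hDt, hz⟩

end Literature.NumberTheory.EllipticCurves.KellerYin2024

end
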